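import Summits.HodgeConjecture.HodgeConjecture.Theses.CyclicUnitaryPowers
import Summits.HodgeConjecture.HodgeConjecture.Theorems.CyclicUnitaryPowersDeckUnitaryGroup

/-!
# Every commutator of the connected deck-unitary group `U⁰(ℂ)` fixes the tensor (step D₂a of crux K2-A)

Helper for stub D₂ `stub_deckUnitaryCommutatorGeneration` of the crux `PowersHodgeOfDeckCommutators`
(stmt-HodgeConjecture-19545, route `CyclicUnitaryPowers`, line `unitary-kunneth-fft` v5, lane 2).  From the
conclusion of the landed stub D₁ (`CyclicUnitaryPowersDeckUnitaryCayleyAscent.stub_deckUnitaryCommutatorAscent`: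
every commutator of CAYLEY-REACHABLE `s_ℂ`-commuting `Q_ℂ`-isometries fixes `ι t`) and the group theory of
`CyclicUnitaryPowersDeckUnitaryGroup` (`Ω` conjugation-stable, `Ω · Ω ⊇ U⁰(ℂ)`, bootstrapping), this file proves
`tensorSpaceActOver_commutator_eq_of_cayleyReachable`: EVERY commutator `γ δ γ⁻¹ δ⁻¹` of elements `γ, δ ∈ U⁰(ℂ)`
(commuting with `s_ℂ`, preserving `Q_ℂ`, fixing the `s_ℂ`-fixed vectors) fixes `ι t` — with no determinant
condition.  What then remains of D₂ is the `SL` layer: an element of `U⁰(ℂ)` with determinant `1` on every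
eigenspace is a product of commutators of `U⁰(ℂ)`.
-/

noncomputable section

open Module
open scoped TensorProduct BigOperators

namespace Summit.HodgeConjecture.HodgeConjecture.Theorems.CyclicUnitaryPowersDeckUnitaryCommutatorsFix

open Literature.AlgebraicGeometry.Motives
open Summit.HodgeConjecture.HodgeConjecture.Theorems.CyclicUnitaryPowersDeckUnitaryGroup

/-- `σ = s_ℂ` has `σ ^ p = 1` if `s ^ p = 1`. [folklore] -/
theorem baseChange_pow_eq_one {V : Type} [AddCommGroup V] [Module ℚ V] (s : V →ₗ[ℚ] V) {p : ℕ} (hsp : s ^ p = 1) :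
    (s.baseChange ℂ) ^ p = 1 := by
  rw [← LinearMap.baseChange_pow, hsp]
  exact LinearMap.baseChange_id

/-- `Q_ℂ` is `s_ℂ`-invariant if `Q` is `s`-invariant. [folklore] -/
theorem baseChange_isometry {V : Type} [AddCommGroup V] [Module ℚ V] (Q : LinearMap.BilinForm ℚ V) (s : V →ₗ[ℚ] V)
    (hsQ : ∀ x y, Q (s x) (s y) = Q x y) (x y : ℂ ⊗[ℚ] V) :
    (Q.baseChange ℂ) ((s.baseChange ℂ) x) ((s.baseChange ℂ) y) = (Q.baseChange ℂ) x y := by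
  induction x using TensorProduct.induction_on generalizing y with
  | zero => simp
  | tmul a v =>
    induction y using TensorProduct.induction_on with
    | zero => simp
    | tmul a' v' =>
      rw [LinearMap.baseChange_tmul, LinearMap.baseChange_tmul, LinearMap.BilinForm.baseChange_tmul,
        LinearMap.BilinForm.baseChange_tmul, hsQ]
    | add y₁ y₂ h₁ h₂ => rw [map_add, map_add, h₁, h₂, map_add]
  | add x₁ x₂ h₁ h₂ => rw [map_add, map_add, LinearMap.add_apply, h₁, h₂, map_add, LinearMap.add_apply]

/-- The stabiliser of one tensor of `T^{r,0}_K W` as a subgroup of `GL_K(W)`. [folklore] -/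
def stabilizerOf {K : Type*} [Field K] {W : Type*} [AddCommGroup W] [Module K W] {r : ℕ}
    (x : hodgeTensorSpaceOver K W r 0) : Subgroup (W ≃ₗ[K] W) where
  carrier := {g | tensorSpaceActOver g x = x}
  one_mem' := by simp
  mul_mem' {g h} hg hh := by
    show tensorSpaceActOver (g * h) x = x
    rw [tensorSpaceActOver_mul_apply, hh, hg]
  inv_mem' {g} hg := by
    show tensorSpaceActOver g⁻¹ x = x
    apply (tensorSpaceActOver (a := r) (b := 0) g).injective
    rw [← tensorSpaceActOver_mul_apply, mul_inv_cancel, tensorSpaceActOver_one, hg]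
    rfl

/-- **Every commutator of `U⁰(ℂ)` fixes `ι t`** (D₂a), from the conclusion of stub D₁ for `t`.
[cite: GoodmanWallachGTM255, §2.2.3 Exercise 1] -/
theorem tensorSpaceActOver_commutator_eq_of_cayleyReachable {V : Type} [AddCommGroup V] [Module ℚ V]
    [Module.Finite ℚ V] (Q : LinearMap.BilinForm ℚ V) (s : V →ₗ[ℚ] V) {p : ℕ} (hp : p.Prime) (h3 : 3 ≤ p)
    (hsp : s ^ p = 1) (hsQ : ∀ x y, Q (s x) (s y) = Q x y) {ζ : ℂ} (hζ : IsPrimitiveRoot ζ p) {r : ℕ}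
    (t : hodgeTensorSpace V r 0)
    (hD1 : ∀ γ δ : (ℂ ⊗[ℚ] V) ≃ₗ[ℂ] (ℂ ⊗[ℚ] V), (∀ x, γ ((s.baseChange ℂ) x) = (s.baseChange ℂ) (γ x)) →
      (∀ x y, (Q.baseChange ℂ) (γ x) (γ y) = (Q.baseChange ℂ) x y) →
      (∀ x, δ ((s.baseChange ℂ) x) = (s.baseChange ℂ) (δ x)) →
      (∀ x y, (Q.baseChange ℂ) (δ x) (δ y) = (Q.baseChange ℂ) x y) →
      IsUnit (LinearMap.det ((γ : ℂ ⊗[ℚ] V →ₗ[ℂ] ℂ ⊗[ℚ] V) + 1)) →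
      IsUnit (LinearMap.det ((δ : ℂ ⊗[ℚ] V →ₗ[ℂ] ℂ ⊗[ℚ] V) + 1)) →
      tensorSpaceActOver (γ * δ * γ⁻¹ * δ⁻¹) (tensorSpaceToBaseChange ℂ V r 0 t) = tensorSpaceToBaseChange ℂ V r 0 t)
    (γ δ : (ℂ ⊗[ℚ] V) ≃ₗ[ℂ] (ℂ ⊗[ℚ] V))
    (hγs : ∀ x, γ ((s.baseChange ℂ) x) = (s.baseChange ℂ) (γ x))
    (hγQ : ∀ x y, (Q.baseChange ℂ) (γ x) (γ y) = (Q.baseChange ℂ) x y)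
    (hγ1 : ∀ x, (s.baseChange ℂ) x = x → γ x = x)
    (hδs : ∀ x, δ ((s.baseChange ℂ) x) = (s.baseChange ℂ) (δ x))
    (hδQ : ∀ x y, (Q.baseChange ℂ) (δ x) (δ y) = (Q.baseChange ℂ) x y)
    (hδ1 : ∀ x, (s.baseChange ℂ) x = x → δ x = x) :
    tensorSpaceActOver (γ * δ * γ⁻¹ * δ⁻¹) (tensorSpaceToBaseChange ℂ V r 0 t) = tensorSpaceToBaseChange ℂ V r 0 t := by
  have hσ := baseChange_pow_eq_one s hsp
  have hB := baseChange_isometry Q s hsQ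
  have hodd : Odd p := hp.odd_of_ne_two (by omega)
  have hmem := commutator_mem_of_cayleyReachable (ζ := ζ) hσ hζ hp.pos hodd hB
    (stabilizerOf (tensorSpaceToBaseChange ℂ V r 0 t))
    (fun a ha b hb => hD1 a b ha.1.1 ha.1.2.1 hb.1.1 hb.1.2.1 ha.2 hb.2)
    (show γ ∈ centIso (s.baseChange ℂ) (Q.baseChange ℂ) from ⟨hγs, hγQ, hγ1⟩)
    (show δ ∈ centIso (s.baseChange ℂ) (Q.baseChange ℂ) from ⟨hδs, hδQ, hδ1⟩)
  exact hmem

end Summit.HodgeConjecture.HodgeConjecture.Theorems.CyclicUnitaryPowersDeckUnitaryCommutatorsFix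

end
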